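import Literature.NumberTheory.GaloisRepresentations.RamificationFiltration
import HarnessLib

/-!
# Discharges of named facts in `RamificationFiltration.lean`: `Γ_K^v ≤ I_𝔓` (trunk GalRep, item C9)

D-0014 keeps `Literature/` sorry-free by stating cited results as named facts `def X : Prop`.
This sibling file proves those facts of
`Literature.NumberTheory.GaloisRepresentations.RamificationFiltration` about the *absolute*
upper-numbering filtration `Γ_K^v = Literature.absUpperRamificationSubgroup R 𝔓 v` that follow from the
definitions and the finite-level API alone, as `theorem X_holds : X` (users holding `(h : X)`
are fed `X_holds`):

* `Literature.NumberTheory.GaloisRepresentations.absUpperRamificationSubgroup_le_inertia_holds` — `Γ_K^v ≤ I_𝔓` for every ideal `𝔓` of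
  `absIntegers R K` and every `v : ℝ`;
* `Literature.NumberTheory.GaloisRepresentations.absUpperInertia_le_absInertia_holds` — its local-field case `I_F^v ≤ I_F`
  (`R = 𝒪[F]`, `𝔓 = absMaximalIdeal F`);
* (transport of structure under conjugation, used by `ArtinConductorProofs.lean` for the
  independence of the Artin conductor from the prime above `v`)
  `Ideal.inertia_smul`, `Ideal.ramificationSubgroup_smul`, `Literature.NumberTheory.GaloisRepresentations.herbrandPhi_smul`,
  `Literature.NumberTheory.GaloisRepresentations.herbrandPsi_smul`, `Literature.NumberTheory.GaloisRepresentations.upperRamificationSubgroup_smul` (finite level: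
  `G_i(τ𝔓) = τ G_i(𝔓) τ⁻¹`, `φ_{τ𝔓} = φ_𝔓`, `ψ_{τ𝔓} = ψ_𝔓`, `G^v(τ𝔓) = τ G^v(𝔓) τ⁻¹`),
  `IntermediateField.comap_integralClosureToAbsIntegers_smul` (`(σ𝔓) ∩ E = σ|_E (𝔓 ∩ E)`) and
  `Literature.NumberTheory.GaloisRepresentations.absUpperRamificationSubgroup_smul` (`Γ_K^v(σ𝔓) = σ Γ_K^v(𝔓) σ⁻¹`);
* (the bottom of the filtration, used by the assembly of Artin–Katz integrality in
  `ArtinConductorProofs.lean`) `Literature.NumberTheory.GaloisRepresentations.herbrandPhi_pos` (`φ(u) > 0` for `u > 0`, finite `G`),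
  `Literature.NumberTheory.GaloisRepresentations.herbrandPsi_of_nonpos_holds` (**discharge** of `herbrandPsi_of_nonpos`: `ψ(v) = v` for
  `v ≤ 0`), `Literature.NumberTheory.GaloisRepresentations.upperRamificationSubgroup_of_nonpos_holds` (**discharge** of
  `upperRamificationSubgroup_of_nonpos`: `G^v = G_0` for `v ≤ 0`) and
  `Literature.NumberTheory.GaloisRepresentations.absUpperRamificationSubgroup_zero_eq_inertia_holds` (**discharge** of
  `absUpperRamificationSubgroup_zero_eq_inertia`: `Γ_K^0 = I_𝔓`) and its local-field case
  `Literature.NumberTheory.GaloisRepresentations.absUpperInertia_zero_holds` (**discharge** of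
  `absUpperInertia_zero`: `I_F^0 = I_F`, `R = 𝒪[F]`, `𝔓 = absMaximalIdeal F`).

These feed `Literature.NumberTheory.GaloisRepresentations.GaloisRep.IsUnramifiedAtPrime.isTameAt_of` and
`Literature.NumberTheory.GaloisRepresentations.WeilDeligneRep.conductor_ofRep_eq_zero_of` of `ArtinConductor.lean` (item C10).

## Proof architecture

Serre (*Local Fields*, Ch. IV §3) defines, for a finite Galois extension with group `G`, the
upper numbering `G^v = G_{ψ(v)}` and notes "`G^{-1} = G`, `G^0 = G_0`" (before Prop. 14), so that
`G^v ⊆ G_0 =` inertia for `v ≥ 0`; in the parent file `upperRamificationSubgroup 𝔓 G v = G_{⌈ψ v⌉₊}`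
is contained in `G_0 = 𝔓.inertia G` for *all* `v` (`Literature.NumberTheory.GaloisRepresentations.upperRamificationSubgroup_le_inertia`,
proved there).  For an infinite Galois extension Serre defines `G^v = lim← G(L'/K)^v` over the
finite Galois subextensions `L'` (Ch. IV §3, Remark 1 after Prop. 15); the parent file's
`absUpperRamificationSubgroup R 𝔓 v` is exactly this: the intersection over the finite normal
subextensions `E/K` of `K̄` of the preimages of `Gal(E/K)^v` (at `𝔓 ∩ E`) under restriction.
Passage to the limit of `G^v ⊆ G_0`: given `σ ∈ Γ_K^v` and an algebraic integer `x ∈ K̄`, the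
normal closure `E` of `K(x)` in `K̄` (Mathlib `IntermediateField.normalClosure`, finite and normal
over `K`) contains `x`; `σ|_E ∈ Gal(E/K)^v ⊆ I(𝔓 ∩ E)` gives `σ|_E • x - x ∈ 𝔓 ∩ E`, and the
(proved) equivariance of the inclusion `integralClosure R E → absIntegers R K`
(`IntermediateField.integralClosureToAbsIntegers_restrictNormalHom_smul`) turns this into
`σ • x - x ∈ 𝔓`, i.e. `σ ∈ I_𝔓`.

Conjugation.  Neukirch (*Algebraic Number Theory*, Ch. I §9, after (9.5) and Prop. (9.6); Ch. II
§9, (9.4)) records that the decomposition, inertia and ramification groups of a conjugate prime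
`σ𝔓` are the conjugates `σ G(𝔓) σ⁻¹`; in particular all numerical invariants (the orders
`#G_i`, hence the Herbrand functions `φ`, `ψ`) of `σ𝔓` and `𝔓` coincide, and the upper-numbering
groups are conjugate as well.  At the absolute level the prime `σ𝔓 ∩ E` of a finite normal
subextension `E` is `σ|_E (𝔓 ∩ E)` by the equivariance of `integralClosure R E → absIntegers R K`,
and conjugation by `σ` commutes with the intersection defining `Γ_K^v`.

Bottom of the filtration.  For finite `G` the integrand `#G_{⌈t⌉₊}/#G_0` of `φ` is at least
`1/#G_0 > 0`, so `φ(u) ≥ u/#G_0 > 0` for `u > 0` (Serre, Ch. IV §3, Prop. 12: `φ` is continuous,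
piecewise linear, increasing), while `φ(u) = u` for `u ≤ 0`; hence `{u | φ u ≤ v} = (-∞, v]` for
`v ≤ 0` and `ψ(v) = sup {u | φ u ≤ v} = v`, `G^v = G_{⌈ψ v⌉₊} = G_0` ("`G^0 = G_0`").  At the
absolute level, `σ ∈ I_𝔓` restricts into the inertia group `G_0 = Gal(E/K)^0` of `𝔓 ∩ E` for
every finite normal `E` (equivariance of `integralClosure R E → absIntegers R K`; Serre, Ch. I
§7, Prop. 22 for the compatibility of inertia with passage to a Galois subextension), so
`I_𝔓 ≤ Γ_K^0`, and `Γ_K^0 ≤ I_𝔓` is the case `v = 0` of the first discharge.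

## References

* J.-P. Serre, *Local Fields*, GTM 67, Springer 1979, Ch. IV §3: the functions `φ`, `ψ`
  (Prop. 12, Prop. 13), the upper numbering `G^v = G_{ψ(v)}`, "`G^0 = G_0`" (before Prop. 14);
  Remark 1 after Prop. 15 (`G^v` for infinite extensions); Ch. I §7, Prop. 22.
  [SerreLocalFields1979]
* J. Neukirch, *Algebraic Number Theory*, Springer 1999, Ch. I §9 (conjugate primes have conjugate
  decomposition and inertia groups, after (9.5)); Ch. II §9–§10 (higher ramification groups).
  [NeukirchANT1999]
-/

noncomputable section

namespace Literature.NumberTheory.GaloisRepresentations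

section AbsoluteLeInertia

open Field
open scoped IntermediateField

variable (R : Type*) {K : Type*} [CommRing R] [Field K] [Algebra R K]

/-- **Discharge of `Literature.NumberTheory.GaloisRepresentations.absUpperRamificationSubgroup_le_inertia`.**  `Γ_K^v ≤ I_𝔓` for every
ideal `𝔓` of `absIntegers R K` and every `v : ℝ`.
Proof: let `σ ∈ Γ_K^v` and `x ∈ absIntegers R K`.  The normal closure `E` of `K(x)` in `K̄`
(Mathlib `IntermediateField.normalClosure`) is a finite normal subextension containing `x`; by
definition of `Γ_K^v` the restriction `σ|_E` lies in `Gal(E/K)^v`, which is contained in the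
inertia group of `𝔓_E = 𝔓 ∩ E` (finite level, `G^v = G_{⌈ψ v⌉₊} ≤ G_0 = I`:
`upperRamificationSubgroup_le_inertia`), so `σ|_E • x - x ∈ 𝔓_E`; by the equivariance of the
inclusion `integralClosure R E → absIntegers R K`
(`IntermediateField.integralClosureToAbsIntegers_restrictNormalHom_smul`) this reads
`σ • x - x ∈ 𝔓`.
Ref: Serre, *Local Fields*, Ch. IV §3: `G^v = G_{ψ(v)}`, "`G^0 = G_0`" (before Prop. 14), and
Remark 1 after Prop. 15 (`G^v = lim← G(L'/K)^v`, `L'` running through the finite Galois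
subextensions).
[cite: SerreLocalFields1979, Ch. IV §3 (before Prop. 14) and Remark 1] -/
theorem absUpperRamificationSubgroup_le_inertia_holds :
    absUpperRamificationSubgroup_le_inertia R (K := K) := by
  intro 𝔓 v σ hσ
  rw [mem_absUpperRamificationSubgroup_iff] at hσ
  refine AddSubgroup.mem_inertia.mpr fun x => ?_
  -- a finite normal subextension `E/K` of `K̄` containing `x`
  have hxint : IsIntegral K (x : AlgebraicClosure K) :=
    (Algebra.IsAlgebraic.isAlgebraic _).isIntegral
  haveI : FiniteDimensional K K⟮(x : AlgebraicClosure K)⟯ :=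
    IntermediateField.adjoin.finiteDimensional hxint
  let E : IntermediateField K (AlgebraicClosure K) :=
    IntermediateField.normalClosure K K⟮(x : AlgebraicClosure K)⟯ (AlgebraicClosure K)
  haveI : FiniteDimensional K E := normalClosure.is_finiteDimensional K _ _
  haveI : Normal K E := normalClosure.normal K _ _
  have hxE : (x : AlgebraicClosure K) ∈ E :=
    IntermediateField.le_normalClosure _ (IntermediateField.mem_adjoin_simple_self K _)
  -- `x` as an element `y` of `integralClosure R E`, mapping to `x` under the inclusion
  have hy : IsIntegral R (⟨x, hxE⟩ : E) :=
    (isIntegral_algHom_iff ((E.val).restrictScalars R) (fun a b h => Subtype.ext h)).mp x.2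
  set y : integralClosure R E := ⟨⟨x, hxE⟩, hy⟩ with hy_def
  have hιy : E.integralClosureToAbsIntegers R y = x := Subtype.ext rfl
  -- finite level: `σ|_E ∈ Gal(E/K)^v ≤ I(𝔓_E)`, then transport along the equivariant inclusion
  have hτ := upperRamificationSubgroup_le_inertia _ _ v (hσ E)
  have h := AddSubgroup.mem_inertia.mp hτ y
  change E.integralClosureToAbsIntegers R (absRestrictNormalHom E σ • y - y) ∈ 𝔓 at h
  rw [map_sub] at h
  have heq : E.integralClosureToAbsIntegers R (absRestrictNormalHom E σ • y) =
      σ • E.integralClosureToAbsIntegers R y :=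
    E.integralClosureToAbsIntegers_restrictNormalHom_smul R σ y
  rwa [heq, hιy] at h

end AbsoluteLeInertia

section LocalLeInertia

open Field ValuativeRel GaloisRepresentations.IsNonarchimedeanLocalField
open scoped Valued

variable (F : Type*) [Field F] [ValuativeRel F] [TopologicalSpace F] [IsNonarchimedeanLocalField F]

/-- **Discharge of `Literature.NumberTheory.GaloisRepresentations.absUpperInertia_le_absInertia`.**  `I_F^v ≤ I_F` for all `v : ℝ`: the
case `R = 𝒪[F]`, `𝔓 = absMaximalIdeal F` of `absUpperRamificationSubgroup_le_inertia_holds`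
(`absInertia F` is by definition the inertia group of `absMaximalIdeal F`).
Ref: Serre, *Local Fields*, Ch. IV §3 (before Prop. 14: `G^0 = G_0`) and Remark 1.
[cite: SerreLocalFields1979, Ch. IV §3 (before Prop. 14) and Remark 1] -/
theorem absUpperInertia_le_absInertia_holds : absUpperInertia_le_absInertia F := fun v =>
  absUpperRamificationSubgroup_le_inertia_holds 𝒪[F] (absMaximalIdeal F) v

end LocalLeInertia

end Literature.NumberTheory.GaloisRepresentations

/-! ### Transport of structure under conjugation (finite level) -/

namespace Ideal

section Conj

open scoped Pointwise

variable {S : Type*} [CommRing S] (𝔓 : Ideal S) (G : Type*) [Group G] [MulSemiringAction G S]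

/-- The inertia group of a conjugate ideal is the conjugate subgroup: `I_{τ • 𝔓} = τ I_𝔓 τ⁻¹`
(companion of `Ideal.decompositionSubgroup_smul`; declared in Mathlib's `Ideal` namespace for dot
notation, Mathlib has no declaration of this name).
Ref: Neukirch, *Algebraic Number Theory*, Ch. I §9, after (9.5) and Prop. (9.6). [folklore] -/
theorem inertia_smul (τ : G) : (τ • 𝔓).inertia G = MulAut.conj τ • 𝔓.inertia G := by
  ext σ
  rw [Subgroup.mem_pointwise_smul_iff_inv_smul_mem, MulAut.smul_def, MulAut.conj_inv_apply,
    AddSubgroup.mem_inertia, AddSubgroup.mem_inertia]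
  constructor
  · intro h x
    have hx := h (τ • x)
    rw [Submodule.mem_toAddSubgroup, Ideal.mem_pointwise_smul_iff_inv_smul_mem, smul_sub,
      inv_smul_smul] at hx
    rwa [Submodule.mem_toAddSubgroup, mul_smul, mul_smul]
  · intro h x
    have hx := h (τ⁻¹ • x)
    rw [Submodule.mem_toAddSubgroup, mul_smul, mul_smul, smul_inv_smul] at hx
    rwa [Submodule.mem_toAddSubgroup, Ideal.mem_pointwise_smul_iff_inv_smul_mem, smul_sub]

/-- The lower-numbering ramification groups of a conjugate ideal are the conjugate subgroups:
`G_i(τ • 𝔓) = τ G_i(𝔓) τ⁻¹` (from `decompositionSubgroup_smul`, `inertia_smul` and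
`(τ • 𝔓) ^ (i+1) = τ • 𝔓 ^ (i+1)`).
Ref: Neukirch, *Algebraic Number Theory*, Ch. I §9, after (9.5); Serre, *Local Fields*, Ch. IV §1.
[folklore] -/
theorem ramificationSubgroup_smul (τ : G) (i : ℕ) :
    (τ • 𝔓).ramificationSubgroup G i = MulAut.conj τ • 𝔓.ramificationSubgroup G i := by
  rw [ramificationSubgroup, ramificationSubgroup, Subgroup.smul_inf, decompositionSubgroup_smul,
    ← smul_pow', inertia_smul]

/-- Conjugate ideals have ramification groups of the same order: `#G_i(τ • 𝔓) = #G_i(𝔓)`.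
Ref: Neukirch, *Algebraic Number Theory*, Ch. I §9, after (9.5). [folklore] -/
theorem card_ramificationSubgroup_smul (τ : G) (i : ℕ) :
    Nat.card ((τ • 𝔓).ramificationSubgroup G i) = Nat.card (𝔓.ramificationSubgroup G i) := by
  rw [ramificationSubgroup_smul]
  exact (Nat.card_congr
    (Subgroup.equivSMul (MulAut.conj τ) (𝔓.ramificationSubgroup G i)).toEquiv).symm

end Conj

end Ideal

namespace Literature.NumberTheory.GaloisRepresentations

section Conj

open scoped Pointwise

variable {S : Type*} [CommRing S] (𝔓 : Ideal S) (G : Type*) [Group G] [MulSemiringAction G S]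

/-- The Herbrand integrand `1/(G_0 : G_{⌈t⌉₊})` is the same for `𝔓` and a conjugate `τ • 𝔓`
(it only involves the orders `#G_i`).  Ref: Serre, *Local Fields*, Ch. IV §3 (definition of
`φ`); Neukirch, *Algebraic Number Theory*, Ch. I §9, after (9.5). [folklore] -/
theorem herbrandIntegrand_smul (τ : G) :
    herbrandIntegrand (τ • 𝔓) G = herbrandIntegrand 𝔓 G := by
  funext t
  simp only [herbrandIntegrand, Ideal.card_ramificationSubgroup_smul]

/-- The Herbrand function `φ` is the same for `𝔓` and a conjugate `τ • 𝔓`.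
Ref: Serre, *Local Fields*, Ch. IV §3 (definition of `φ`). [folklore] -/
theorem herbrandPhi_smul (τ : G) : herbrandPhi (τ • 𝔓) G = herbrandPhi 𝔓 G := by
  funext u
  simp only [herbrandPhi, herbrandIntegrand_smul]

/-- The inverse Herbrand function `ψ` is the same for `𝔓` and a conjugate `τ • 𝔓`.
Ref: Serre, *Local Fields*, Ch. IV §3 (definition of `ψ`). [folklore] -/
theorem herbrandPsi_smul (τ : G) : herbrandPsi (τ • 𝔓) G = herbrandPsi 𝔓 G := by
  funext v
  simp only [herbrandPsi, herbrandPhi_smul]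

/-- The upper-numbering ramification groups of a conjugate ideal are the conjugate subgroups:
`G^v(τ • 𝔓) = τ G^v(𝔓) τ⁻¹`.  Ref: Serre, *Local Fields*, Ch. IV §3 (definition of `G^v`);
Neukirch, *Algebraic Number Theory*, Ch. I §9, after (9.5). [folklore] -/
theorem upperRamificationSubgroup_smul (τ : G) (v : ℝ) :
    upperRamificationSubgroup (τ • 𝔓) G v =
      MulAut.conj τ • upperRamificationSubgroup 𝔓 G v := by
  rw [upperRamificationSubgroup, upperRamificationSubgroup, herbrandPsi_smul,
    Ideal.ramificationSubgroup_smul]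

end Conj

/-! ### Transport of structure under conjugation (absolute level) -/

section AbsoluteConj

open Field
open scoped Pointwise

/-- Pulling back a conjugate subgroup along a group homomorphism `f`:
`f⁻¹((f σ) U (f σ)⁻¹) = σ f⁻¹(U) σ⁻¹` (elementary group theory; Mathlib has no declaration of
this name). [folklore] -/
theorem _root_.Subgroup.comap_conj_smul {Γ G : Type*} [Group Γ] [Group G] (f : Γ →* G) (σ : Γ)
    (U : Subgroup G) :
    (MulAut.conj (f σ) • U).comap f = MulAut.conj σ • U.comap f := by
  ext x
  simp only [Subgroup.mem_comap, Subgroup.mem_pointwise_smul_iff_inv_smul_mem, MulAut.smul_def,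
    MulAut.conj_inv_apply, map_mul, map_inv]

variable (R : Type*) {K : Type*} [CommRing R] [Field K] [Algebra R K]

/-- For a finite normal subextension `E/K` of `K̄` and `σ ∈ Gal(K̄/K)`, the prime of `E` below the
conjugate `σ • 𝔓` is the conjugate by `σ|_E` of the prime below `𝔓`:
`(σ𝔓) ∩ E = σ|_E • (𝔓 ∩ E)` (from the equivariance
`IntermediateField.integralClosureToAbsIntegers_restrictNormalHom_smul`).  Declared in Mathlib's
`IntermediateField` namespace for dot notation, like `integralClosureToAbsIntegers`.
Ref: Serre, *Local Fields*, Ch. I §7, Prop. 22 (compatibility with subextensions); Neukirch,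
*Algebraic Number Theory*, Ch. I §9, after (9.5). [folklore] -/
theorem _root_.IntermediateField.comap_integralClosureToAbsIntegers_smul
    (E : IntermediateField K (AlgebraicClosure K)) [Normal K E] (σ : absoluteGaloisGroup K)
    (𝔓 : Ideal (absIntegers R K)) :
    (σ • 𝔓).comap (E.integralClosureToAbsIntegers R) =
      absRestrictNormalHom E σ • 𝔓.comap (E.integralClosureToAbsIntegers R) := by
  ext x
  have h := E.integralClosureToAbsIntegers_restrictNormalHom_smul R σ⁻¹ x
  rw [Ideal.mem_comap, Ideal.mem_pointwise_smul_iff_inv_smul_mem,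
    Ideal.mem_pointwise_smul_iff_inv_smul_mem, Ideal.mem_comap, ← map_inv, ← h]
  rfl

/-- **The absolute upper-numbering filtration of a conjugate prime is the conjugate filtration**:
`Γ_K^v(σ • 𝔓) = σ Γ_K^v(𝔓) σ⁻¹` for every ideal `𝔓` of `absIntegers R K`, `σ ∈ Gal(K̄/K)` and
`v : ℝ`.  Proof: for each finite normal `E/K`, `(σ𝔓) ∩ E = σ|_E (𝔓 ∩ E)`
(`comap_integralClosureToAbsIntegers_smul`), the finite-level groups of a conjugate prime are the
conjugates (`upperRamificationSubgroup_smul`), preimages of conjugates are conjugates of preimages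
(`Subgroup.comap_conj_smul`), and conjugation commutes with the intersection over `E`.
Ref: Serre, *Local Fields*, Ch. IV §3, Remark 1 after Prop. 15 (`G^v` for infinite extensions);
Neukirch, *Algebraic Number Theory*, Ch. I §9, after (9.5) (conjugate primes, conjugate groups).
[folklore] -/
theorem absUpperRamificationSubgroup_smul (σ : absoluteGaloisGroup K)
    (𝔓 : Ideal (absIntegers R K)) (v : ℝ) :
    absUpperRamificationSubgroup R (σ • 𝔓) v =
      MulAut.conj σ • absUpperRamificationSubgroup R 𝔓 v := by
  ext x
  rw [Subgroup.mem_pointwise_smul_iff_inv_smul_mem, mem_absUpperRamificationSubgroup_iff,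
    mem_absUpperRamificationSubgroup_iff]
  refine forall_congr' fun E => forall_congr' fun _ => forall_congr' fun _ => ?_
  rw [IntermediateField.comap_integralClosureToAbsIntegers_smul, upperRamificationSubgroup_smul,
    ← Subgroup.mem_comap, Subgroup.comap_conj_smul, Subgroup.mem_pointwise_smul_iff_inv_smul_mem,
    Subgroup.mem_comap]

/-- The inertia group of a conjugate prime of `absIntegers R K` in `Gal(K̄/K)` is the conjugate:
`I_{σ𝔓} = σ I_𝔓 σ⁻¹` (the case `G = Gal(K̄/K)` of `Ideal.inertia_smul`, recorded for the
non-reducible `def` `Field.absoluteGaloisGroup`).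
Ref: Neukirch, *Algebraic Number Theory*, Ch. I §9, after (9.5) and Prop. (9.6). [folklore] -/
theorem absIntegers.inertia_smul (σ : absoluteGaloisGroup K) (𝔓 : Ideal (absIntegers R K)) :
    (σ • 𝔓).inertia (absoluteGaloisGroup K) =
      MulAut.conj σ • 𝔓.inertia (absoluteGaloisGroup K) :=
  Ideal.inertia_smul 𝔓 (absoluteGaloisGroup K) σ

end AbsoluteConj

/-! ### The bottom of the filtration: `ψ(v) = v` and `G^v = G_0` for `v ≤ 0`; `Γ_K^0 = I_𝔓` -/

section HerbrandBottom

open MeasureTheory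

variable {S : Type*} [CommRing S] (𝔓 : Ideal S) (G : Type*) [Group G] [MulSemiringAction G S]

/-- For finite `G` the Herbrand integrand `#G_{⌈t⌉₊}/#G_0` is bounded below by `1/#G_0`
(`#G_i ≥ 1`).  Ref: Serre, *Local Fields*, Ch. IV §3, definition of `φ`. [folklore] -/
theorem inv_card_le_herbrandIntegrand [Finite G] (t : ℝ) :
    ((Nat.card (𝔓.ramificationSubgroup G 0) : ℝ))⁻¹ ≤ herbrandIntegrand 𝔓 G t := by
  rw [herbrandIntegrand, inv_div, inv_eq_one_div]
  gcongr
  exact Nat.one_le_cast.mpr Nat.card_pos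

/-- For finite `G` the Herbrand integrand is non-increasing (`G_i` decreases with `i`).
Ref: Serre, *Local Fields*, Ch. IV §3 (the slopes `1/(G_0 : G_i)` of `φ` decrease). [folklore] -/
theorem herbrandIntegrand_antitone [Finite G] : Antitone (herbrandIntegrand 𝔓 G) := by
  intro s t hst
  simp only [herbrandIntegrand, inv_div]
  gcongr
  exact Subgroup.card_le_of_le (𝔓.ramificationSubgroup_antitone G (Nat.ceil_le_ceil hst))

/-- For finite `G` and `u > 0`, `φ(u) > 0` (indeed `φ(u) ≥ u/#G_0`).
Ref: Serre, *Local Fields*, Ch. IV §3, Prop. 12 (`φ` is strictly increasing with `φ(0) = 0`).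
[folklore] -/
theorem herbrandPhi_pos [Finite G] {u : ℝ} (hu : 0 < u) : 0 < herbrandPhi 𝔓 G u := by
  rw [herbrandPhi]
  have hint : IntervalIntegrable (herbrandIntegrand 𝔓 G) volume 0 u :=
    ((herbrandIntegrand_antitone 𝔓 G).antitoneOn _).intervalIntegrable
  calc (0 : ℝ) < ∫ _ in (0 : ℝ)..u, ((Nat.card (𝔓.ramificationSubgroup G 0) : ℝ))⁻¹ := by
        rw [intervalIntegral.integral_const, smul_eq_mul, sub_zero]
        exact mul_pos hu (inv_pos.mpr (Nat.cast_pos.mpr Nat.card_pos))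
    _ ≤ ∫ t in (0 : ℝ)..u, herbrandIntegrand 𝔓 G t :=
        intervalIntegral.integral_mono_on hu.le intervalIntegrable_const hint
          fun t _ => inv_card_le_herbrandIntegrand 𝔓 G t

/-- **Discharge of `Literature.NumberTheory.GaloisRepresentations.herbrandPsi_of_nonpos`.**  For finite `G` and `v ≤ 0`, `ψ(v) = v`:
the set `{u | φ u ≤ v}` whose supremum defines `ψ(v)` is exactly `(-∞, v]`, because `φ(u) = u`
for `u ≤ 0` (`herbrandPhi_of_nonpos`) and `φ(u) > 0 ≥ v` for `u > 0` (`herbrandPhi_pos`).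
Ref: Serre, *Local Fields*, Ch. IV §3 (`ψ = φ⁻¹`, and `φ`, `ψ` are the identity on `[-1, 0]`).
[cite: SerreLocalFields1979, Ch. IV §3 (before Prop. 13)] -/
theorem herbrandPsi_of_nonpos_holds : herbrandPsi_of_nonpos 𝔓 G := by
  intro _ v hv
  rw [herbrandPsi]
  have hset : {u : ℝ | herbrandPhi 𝔓 G u ≤ v} = Set.Iic v := by
    ext u
    simp only [Set.mem_setOf_eq, Set.mem_Iic]
    refine ⟨fun h => ?_, fun h => by rwa [herbrandPhi_of_nonpos 𝔓 (h.trans hv)]⟩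
    by_contra hu
    rcases le_or_gt u 0 with hu0 | hu0
    · rw [herbrandPhi_of_nonpos 𝔓 hu0] at h
      exact hu h
    · exact (not_le.mpr (herbrandPhi_pos 𝔓 G hu0)) (h.trans hv)
  rw [hset, csSup_Iic]

/-- **Discharge of `Literature.NumberTheory.GaloisRepresentations.upperRamificationSubgroup_of_nonpos`.**  For finite `G` and `v ≤ 0`,
`G^v = G_{⌈ψ v⌉₊} = G_0 = I_𝔓` (`ψ(v) = v ≤ 0`, so `⌈ψ v⌉₊ = 0`).
Ref: Serre, *Local Fields*, Ch. IV §3 ("`G^{-1} = G`, `G^0 = G_0`", before Prop. 14).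
[cite: SerreLocalFields1979, Ch. IV §3 (before Prop. 14)] -/
theorem upperRamificationSubgroup_of_nonpos_holds : upperRamificationSubgroup_of_nonpos 𝔓 G := by
  intro _ v hv
  rw [upperRamificationSubgroup, herbrandPsi_of_nonpos_holds 𝔓 G hv, Nat.ceil_eq_zero.mpr hv,
    Ideal.ramificationSubgroup_zero]

end HerbrandBottom

section AbsoluteZero

open Field

variable (R : Type*) {K : Type*} [CommRing R] [Field K] [Algebra R K]

/-- **Discharge of `Literature.NumberTheory.GaloisRepresentations.absUpperRamificationSubgroup_zero_eq_inertia`.**  `Γ_K^0 = I_𝔓`: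
`≤` is `absUpperRamificationSubgroup_le_inertia_holds`; conversely, for `σ ∈ I_𝔓` and every
finite normal `E/K ⊆ K̄`, `Gal(E/K)^0 = G_0` is the inertia group of `𝔓 ∩ E`
(`upperRamificationSubgroup_of_nonpos_holds`), which contains `σ|_E` by the equivariance of the
inclusion `integralClosure R E → absIntegers R K`
(`IntermediateField.integralClosureToAbsIntegers_restrictNormalHom_smul`).
Ref: Serre, *Local Fields*, Ch. IV §3, "`G^0 = G_0`" (before Prop. 14) and Remark 1; Ch. I §7,
Prop. 22 (inertia and restriction). [cite: SerreLocalFields1979, Ch. IV §3 Remark 1 and Ch. I §7 Prop. 22] -/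
theorem absUpperRamificationSubgroup_zero_eq_inertia_holds :
    absUpperRamificationSubgroup_zero_eq_inertia R (K := K) := by
  intro 𝔓
  refine le_antisymm (absUpperRamificationSubgroup_le_inertia_holds R 𝔓 0) fun σ hσ => ?_
  rw [mem_absUpperRamificationSubgroup_iff]
  intro E _ _
  rw [upperRamificationSubgroup_of_nonpos_holds _ _ le_rfl]
  refine AddSubgroup.mem_inertia.mpr fun y => ?_
  change E.integralClosureToAbsIntegers R (absRestrictNormalHom E σ • y - y) ∈ 𝔓
  have heq : E.integralClosureToAbsIntegers R (absRestrictNormalHom E σ • y) =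
      σ • E.integralClosureToAbsIntegers R y :=
    E.integralClosureToAbsIntegers_restrictNormalHom_smul R σ y
  rw [map_sub, heq]
  exact AddSubgroup.mem_inertia.mp hσ _

end AbsoluteZero

section LocalZero

open Field ValuativeRel GaloisRepresentations.IsNonarchimedeanLocalField
open scoped Valued

variable (F : Type*) [Field F] [ValuativeRel F] [TopologicalSpace F] [IsNonarchimedeanLocalField F]

/-- **Discharge of `Literature.NumberTheory.GaloisRepresentations.absUpperInertia_zero`.**  `I_F^0 = I_F`
for a non-archimedean local field `F`: the case `R = 𝒪[F]`, `𝔓 = absMaximalIdeal F` of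
`absUpperRamificationSubgroup_zero_eq_inertia_holds` (`Γ_K^0 = I_𝔓`), since `absUpperInertia F v`
is `absUpperRamificationSubgroup 𝒪[F] (absMaximalIdeal F) v` and `absInertia F` is by definition
the inertia group `(absMaximalIdeal F).inertia Γ_F` of the same prime.
Ref: Serre, *Local Fields*, Ch. IV §3: "`G^{-1} = G`, `G^0 = G_0`" (definition of the upper
numbering, before Prop. 14) and Remark 1 after the proof of Prop. 14 (`G^v = lim← G(L'/K)^v` for an
infinite Galois extension, `L'` running through the finite Galois subextensions); Ch. I §7,
Prop. 22 (inertia and passage to a Galois subextension).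
[cite: SerreLocalFields1979, Ch. IV §3 (before Prop. 14) and Remark 1; Ch. I §7 Prop. 22] -/
theorem absUpperInertia_zero_holds : absUpperInertia_zero F :=
  absUpperRamificationSubgroup_zero_eq_inertia_holds 𝒪[F] (absMaximalIdeal F)

end LocalZero

end Literature.NumberTheory.GaloisRepresentations
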